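import Summits.KontsevichZagierPeriods.KontsevichZagierPeriods.Theorems.RootDecompRelativeModAbsoluteCylLogSplitP38

/-! # `RootDecompRelativeModAbsoluteCylLogSplitP39` — part 14/27 of the mechanical ≤400-line split of `RungClosure.lean` (sha256 f909f334226f0fb5…)
Source: decomp-kz lens-3 g12 `RungClosure.lean` v9 (HOME/decomp-kz-lens-3/g12/, sha256 f909f334…; critic g4-52/g4-57/g5 CLEARED, «lander: split v9 --supports 30572»): BLOCK I (57 g11 monolith decls missing from P01–P25), BLOCK II/III (WildCertAssembly parts 1–6, 8–10: `Leaf.cellLocalWildCert`, `Leaf.cylKernelZeroLog_of_trees`), Parts 12–13 (`Leaf.regKernelPairDegOne_iff_circlePos_of_trees`), BLOCK G13 (Möbius engine, test §C decided).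
Split by census-1 g9 `gen/splitlean.py`: scopes re-opened with their `open`/`variable`/`set_option` context; mathematics and declaration order unchanged. -/

noncomputable section
open Set MeasureTheory Filter Topology
open scoped BigOperators
open Literature.NumberTheory.Transcendental Literature.ModelTheory.ExponentialFields
namespace Summit.KontsevichZagierPeriods.RootDecompRelativeModAbsolute.Rung30571.RegularisedLogLayer.CylLogLeaf

/-- `segBelow E r`, read on the line, is an open interval `(e, r)` whose left end `e` is NOT in `E` (the singular end), or the ray `(−∞, r)`. -/
theorem segBelow_eq_Ioo_or_Iio {E : Set (Fin 1 → ℝ)} (hEo : IsOpen E) {r : ℚ} (hr : (fun _ : Fin 1 => (r : ℝ)) ∈ E) :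
    (∃ e : ℝ, e < r ∧ segBelow E r = {w | w 0 ∈ Set.Ioo e (r : ℝ)} ∧ (fun _ : Fin 1 => e) ∉ E) ∨
      segBelow E r = {w | w 0 < (r : ℝ)} := by
  set E₀ : Set ℝ := (fun t : ℝ => fun _ : Fin 1 => t) ⁻¹' E with hE₀
  have hE₀o : IsOpen E₀ := hEo.preimage (continuous_pi fun _ => continuous_id)
  -- the piece read on the line
  set S : Set ℝ := {t | t < (r : ℝ) ∧ ∀ y : ℝ, t ≤ y → y < (r : ℝ) → (fun _ : Fin 1 => y) ∈ E} with hS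
  have hmem : ∀ w : Fin 1 → ℝ, w ∈ segBelow E r ↔ w 0 ∈ S := fun w => Iff.rfl
  have hmono : ∀ t ∈ S, ∀ t', t ≤ t' → t' < (r : ℝ) → t' ∈ S :=
    fun t ht t' h1 h2 => ⟨h2, fun y hy hy' => ht.2 y (h1.trans hy) hy'⟩
  -- `S` is open and nonempty
  have hSo : IsOpen S := by
    have : S = (fun t : ℝ => fun _ : Fin 1 => t) ⁻¹' segBelow E r := rfl
    rw [this]
    exact (isOpen_segBelow hEo r).preimage (continuous_pi fun _ => continuous_id)
  have hrE : (r : ℝ) ∈ E₀ := hr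
  obtain ⟨ε, hε, hball⟩ := Metric.isOpen_iff.1 hE₀o (r : ℝ) hrE
  have hS0 : (r : ℝ) - ε / 2 ∈ S := by
    refine ⟨by linarith, fun y hy hy' => hball ?_⟩
    rw [Metric.mem_ball, Real.dist_eq, abs_lt]
    constructor <;> linarith
  have hSne : S.Nonempty := ⟨_, hS0⟩
  -- below any point of `S` there is another point of `S`
  have hbelow : ∀ t ∈ S, ∃ t' ∈ S, t' < t := by
    intro t ht
    obtain ⟨η, hη, hb⟩ := Metric.isOpen_iff.1 hSo t ht
    refine ⟨t - η / 2, hb ?_, by linarith⟩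
    rw [Metric.mem_ball, Real.dist_eq, abs_lt]
    constructor <;> linarith
  by_cases hbdd : BddBelow S
  · left
    refine ⟨sInf S, ?_, ?_, ?_⟩
    · obtain ⟨t', ht', hlt⟩ := hbelow _ hS0
      exact lt_of_le_of_lt (csInf_le hbdd ht') (by linarith)
    · ext w
      rw [hmem]
      constructor
      · intro hw
        obtain ⟨t', ht', hlt⟩ := hbelow _ hw
        exact ⟨lt_of_le_of_lt (csInf_le hbdd ht') hlt, hw.1⟩
      · rintro ⟨h1, h2⟩
        obtain ⟨s, hs, hsw⟩ := exists_lt_of_csInf_lt hSne h1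
        exact hmono s hs _ hsw.le h2
    · intro heE
      have heE₀ : sInf S ∈ E₀ := heE
      obtain ⟨η, hη, hb⟩ := Metric.isOpen_iff.1 hE₀o _ heE₀
      -- a point of `S` just above `sInf S`
      have hlt : sInf S < min (sInf S + η / 2) ((r : ℝ) - ε / 2) := by
        refine lt_min (by linarith) ?_
        obtain ⟨t', ht', hlt⟩ := hbelow _ hS0
        exact lt_of_le_of_lt (csInf_le hbdd ht') hlt
      obtain ⟨t₀, ht₀, ht₀lt⟩ := exists_lt_of_csInf_lt hSne hlt
      have ht₀' : t₀ < sInf S + η / 2 := lt_of_lt_of_le ht₀lt (min_le_left _ _)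
      -- then `sInf S - η/2 ∈ S`, contradiction
      have hmemS : sInf S - η / 2 ∈ S := by
        refine ⟨by linarith [ht₀.1, csInf_le hbdd ht₀], fun y hy hy' => ?_⟩
        by_cases hyt : y < t₀
        · exact hb (by rw [Metric.mem_ball, Real.dist_eq, abs_lt]; constructor <;> linarith)
        · exact ht₀.2 y (not_lt.1 hyt) hy'
      have := csInf_le hbdd hmemS
      linarith
  · right
    ext w
    rw [hmem]
    constructor
    · intro hw
      exact hw.1
    · intro hw
      obtain ⟨s, hs, hsw⟩ := not_bddBelow_iff.1 hbdd (w 0)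
      exact hmono s hs _ hsw.le hw

/-- `segAbove E r`, read on the line, is an open interval `(r, e)` whose right end `e` is NOT in `E` (the singular end), or the ray `(r, ∞)`. -/
theorem segAbove_eq_Ioo_or_Ioi {E : Set (Fin 1 → ℝ)} (hEo : IsOpen E) {r : ℚ} (hr : (fun _ : Fin 1 => (r : ℝ)) ∈ E) :
    (∃ e : ℝ, (r : ℝ) < e ∧ segAbove E r = {w | w 0 ∈ Set.Ioo (r : ℝ) e} ∧ (fun _ : Fin 1 => e) ∉ E) ∨
      segAbove E r = {w | (r : ℝ) < w 0} := by
  set E₀ : Set ℝ := (fun t : ℝ => fun _ : Fin 1 => t) ⁻¹' E with hE₀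
  have hE₀o : IsOpen E₀ := hEo.preimage (continuous_pi fun _ => continuous_id)
  set S : Set ℝ := {t | (r : ℝ) < t ∧ ∀ y : ℝ, (r : ℝ) < y → y ≤ t → (fun _ : Fin 1 => y) ∈ E} with hS
  have hmem : ∀ w : Fin 1 → ℝ, w ∈ segAbove E r ↔ w 0 ∈ S := fun w => Iff.rfl
  have hmono : ∀ t ∈ S, ∀ t', t' ≤ t → (r : ℝ) < t' → t' ∈ S :=
    fun t ht t' h1 h2 => ⟨h2, fun y hy hy' => ht.2 y hy (hy'.trans h1)⟩
  have hSo : IsOpen S := by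
    have : S = (fun t : ℝ => fun _ : Fin 1 => t) ⁻¹' segAbove E r := rfl
    rw [this]
    exact (isOpen_segAbove hEo r).preimage (continuous_pi fun _ => continuous_id)
  have hrE : (r : ℝ) ∈ E₀ := hr
  obtain ⟨ε, hε, hball⟩ := Metric.isOpen_iff.1 hE₀o (r : ℝ) hrE
  have hS0 : (r : ℝ) + ε / 2 ∈ S := by
    refine ⟨by linarith, fun y hy hy' => hball ?_⟩
    rw [Metric.mem_ball, Real.dist_eq, abs_lt]
    constructor <;> linarith
  have hSne : S.Nonempty := ⟨_, hS0⟩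
  have habove : ∀ t ∈ S, ∃ t' ∈ S, t < t' := by
    intro t ht
    obtain ⟨η, hη, hb⟩ := Metric.isOpen_iff.1 hSo t ht
    refine ⟨t + η / 2, hb ?_, by linarith⟩
    rw [Metric.mem_ball, Real.dist_eq, abs_lt]
    constructor <;> linarith
  by_cases hbdd : BddAbove S
  · left
    refine ⟨sSup S, ?_, ?_, ?_⟩
    · obtain ⟨t', ht', hlt⟩ := habove _ hS0
      exact lt_of_lt_of_le (by linarith) (le_csSup hbdd ht')
    · ext w
      rw [hmem]
      constructor
      · intro hw
        obtain ⟨t', ht', hlt⟩ := habove _ hw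
        exact ⟨hw.1, lt_of_lt_of_le hlt (le_csSup hbdd ht')⟩
      · rintro ⟨h1, h2⟩
        obtain ⟨s, hs, hsw⟩ := exists_lt_of_lt_csSup hSne h2
        exact hmono s hs _ hsw.le h1
    · intro heE
      have heE₀ : sSup S ∈ E₀ := heE
      obtain ⟨η, hη, hb⟩ := Metric.isOpen_iff.1 hE₀o _ heE₀
      have hlt : max (sSup S - η / 2) ((r : ℝ) + ε / 2) < sSup S := by
        refine max_lt (by linarith) ?_
        obtain ⟨t', ht', hlt⟩ := habove _ hS0
        exact lt_of_lt_of_le hlt (le_csSup hbdd ht')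
      obtain ⟨t₀, ht₀, ht₀lt⟩ := exists_lt_of_lt_csSup hSne hlt
      have ht₀' : sSup S - η / 2 < t₀ := lt_of_le_of_lt (le_max_left _ _) ht₀lt
      have hmemS : sSup S + η / 2 ∈ S := by
        refine ⟨by linarith [ht₀.1, le_csSup hbdd ht₀], fun y hy hy' => ?_⟩
        by_cases hyt : t₀ < y
        · exact hb (by rw [Metric.mem_ball, Real.dist_eq, abs_lt]; constructor <;> linarith)
        · exact ht₀.2 y hy (not_lt.1 hyt)
      have := le_csSup hbdd hmemS
      linarith
  · right
    ext w
    rw [hmem]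
    constructor
    · intro hw
      exact hw.1
    · intro hw
      obtain ⟨s, hs, hsw⟩ := not_bddAbove_iff.1 hbdd (w 0)
      exact hmono s hs _ hsw.le hw

end Summit.KontsevichZagierPeriods.RootDecompRelativeModAbsolute.Rung30571.RegularisedLogLayer.CylLogLeaf

/-! ## Part 6 — `Transport_v2` (g11 companion, verbatim body) -/

namespace Summit.KontsevichZagierPeriods.RootDecompRelativeModAbsolute.Rung30571.RegularisedLogLayer.CylLogLeaf

/-- **Transport of the end `+∞` to `0⁺`.**  If `x ↦ φ x₀` is `ℚ`-semialgebraic on the ray `{r < x₀}` (`r ∈ ℚ`), then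
`x ↦ φ (r − 1 + x₀⁻¹)` is `ℚ`-semialgebraic on `{0 < x₀ < 1}`. -/
theorem isSemialgebraicFunOn_transportInv {φ : ℝ → ℝ} {r : ℚ}
    (hφ : IsSemialgebraicFunOn ℚ {x : Fin 1 → ℝ | (r : ℝ) < x 0} (fun x => φ (x 0))) :
    IsSemialgebraicFunOn ℚ {x : Fin 1 → ℝ | x 0 ∈ Set.Ioo (0 : ℝ) 1} (fun x => φ ((r : ℝ) - 1 + (x 0)⁻¹)) := by
  classical
  rw [isSemialgebraicFunOn_iff] at hφ ⊢
  -- coordinates on `Fin 3`: `v 0 = t`, `v 1 = u`, `v 2 = y`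
  let σ : Fin 2 → Fin 3 := fun i => if i = 0 then 0 else 2
  have hG := hφ.preimage_comp σ
  let W : Set (Fin 3 → ℝ) :=
    {v | 0 < v 1} ∩ ({v | v 1 < 1} ∩ ({v | (v 0 - (r : ℝ) + 1) * v 1 - 1 = 0} ∩
      ((fun v : Fin 3 → ℝ => v ∘ σ) ⁻¹'
        {z : Fin (1 + 1) → ℝ | Fin.init z ∈ {x : Fin 1 → ℝ | (r : ℝ) < x 0} ∧ z (Fin.last 1) = φ (Fin.init z 0)})))
  have hW : IsSemialgebraic ℚ W := by
    refine IsSemialgebraic.inter ?_ (IsSemialgebraic.inter ?_ (IsSemialgebraic.inter ?_ hG))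
    · simpa using isSemialgebraic_setOf_eval_pos (k := ℚ) (R := ℝ) (ι := Fin 3) (MvPolynomial.X 1)
    · simpa using isSemialgebraic_setOf_eval_lt (k := ℚ) (R := ℝ) (ι := Fin 3) (MvPolynomial.X 1) (MvPolynomial.C 1)
    · have h3 := isSemialgebraic_setOf_eval_eq_zero (k := ℚ) (R := ℝ) (ι := Fin 3)
        ((MvPolynomial.X 0 - MvPolynomial.C r + 1) * MvPolynomial.X 1 - 1)
      convert h3 using 2 with v
      simp
  have himg := hW.image_tail
  convert himg using 1
  ext z
  simp only [mem_setOf_eq, mem_image, Set.mem_Ioo]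
  have hinit0 : ∀ w : Fin (1 + 1) → ℝ, Fin.init w 0 = w 0 := fun w => rfl
  have hlast : ∀ w : Fin (1 + 1) → ℝ, w (Fin.last 1) = w 1 := fun w => rfl
  simp only [hinit0, hlast]
  constructor
  · rintro ⟨⟨h0, h1⟩, hy⟩
    refine ⟨fun i => if i = 0 then (r : ℝ) - 1 + (z 0)⁻¹ else if i = 1 then z 0 else z 1, ?_, ?_⟩
    · simp only [W, mem_inter_iff, mem_setOf_eq, mem_preimage]
      refine ⟨by simpa using h0, by simpa using h1, ?_, ?_⟩
      · simp only [Fin.isValue, one_ne_zero, ↓reduceIte]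
        field_simp
        ring
      · simp only [hinit0, hlast]
        refine ⟨?_, ?_⟩
        · show (r : ℝ) < (fun i : Fin 3 => if i = 0 then (r : ℝ) - 1 + (z 0)⁻¹ else if i = 1 then z 0 else z 1) (σ 0)
          simp only [σ, Fin.isValue, ↓reduceIte]
          have : 1 < (z 0)⁻¹ := (one_lt_inv₀ h0).2 h1
          linarith
        · show (fun i : Fin 3 => if i = 0 then (r : ℝ) - 1 + (z 0)⁻¹ else if i = 1 then z 0 else z 1) (σ 1) =
            φ ((fun i : Fin 3 => if i = 0 then (r : ℝ) - 1 + (z 0)⁻¹ else if i = 1 then z 0 else z 1) (σ 0))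
          simp only [σ, Fin.isValue, one_ne_zero, ↓reduceIte]
          simpa using hy
    · funext i
      fin_cases i <;> simp
  · rintro ⟨v, hv, hvz⟩
    simp only [W, mem_inter_iff, mem_setOf_eq, mem_preimage, hinit0, hlast] at hv
    obtain ⟨h0, h1, hrel, hgr⟩ := hv
    have hz0 : z 0 = v 1 := by
      have := congr_fun hvz 0; simpa using this.symm
    have hz1 : z 1 = v 2 := by
      have := congr_fun hvz 1; simpa using this.symm
    have hσ0 : (v ∘ σ) 0 = v 0 := by simp [σ]
    have hσ1 : (v ∘ σ) 1 = v 2 := by simp [σ]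
    rw [hσ0, hσ1] at hgr
    have hv1 : v 1 ≠ 0 := h0.ne'
    have hv0 : v 0 = (r : ℝ) - 1 + (v 1)⁻¹ := by
      field_simp
      linarith [hrel]
    refine ⟨⟨by rwa [hz0], by rwa [hz0]⟩, ?_⟩
    rw [hz0, hz1, ← hv0]
    exact hgr.2

/-- Limits transport along the same substitution: a limit of `φ` at `+∞` is the limit of `u ↦ φ (r − 1 + u⁻¹)` at `0⁺`
(so `κ → 0` at the end `+∞` feeds `rates_at_end` / `left_end_dichotomy` at the end `0⁺` of the transported piece). -/
theorem tendsto_transportInv {φ : ℝ → ℝ} (r : ℝ) {l : Filter ℝ} (h : Filter.Tendsto φ Filter.atTop l) :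
    Filter.Tendsto (fun u : ℝ => φ (r - 1 + u⁻¹)) (nhdsWithin (0 : ℝ) (Set.Ioi 0)) l :=
  h.comp (Filter.tendsto_atTop_add_const_left _ _ tendsto_inv_nhdsGT_zero)

end Summit.KontsevichZagierPeriods.RootDecompRelativeModAbsolute.Rung30571.RegularisedLogLayer.CylLogLeaf

/-! # BLOCK III — the g12 mathematics (Parts 8–10 of `WildCertAssembly.lean`) in the sub-namespace `…CylLog.Leaf`;
`multUp… / logCoef / polyPart / sgnB / TameCell / zW / WildCellCert / LocalWildCert / CellLocalWildCert /
localWildCert_of_tameCell / _of_wildCellCert / _of_pieces` are the BLOCK I / landed declarations of `…CylLog`. -/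

namespace Summit.KontsevichZagierPeriods.RootDecompRelativeModAbsolute.Rung30571.RegularisedLogLayer.CylLog.Leaf

/-! ## Part 8 — the Γ-form of the lattice split (g12): the coefficient matrix `A` of the `Z`-supported relations
factors through the relation vectors, `A s r = Σ_k α_sk f_rk`, so that on a cell `qq'_s = Σ_r A_sr qq_r = Σ_k α_sk d̂_k`
is a `ℚ`-combination of the log-coefficients `d̂_k = Σ_r qq_r f_rk` themselves (every wild integrand becomes
`L¹ × bounded`). -/

end Summit.KontsevichZagierPeriods.RootDecompRelativeModAbsolute.Rung30571.RegularisedLogLayer.CylLog.Leaf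
end
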